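import Summits.Ventures.YMGap.Thresholds.LatticeBakryEmeryIntegration
import Summits.Ventures.YMGap.Thresholds.LatticeBakryEmeryPolynomials
import HarnessLib

/-!
# Venture YMGap — multi-link Bakry–Émery calculus, Part F2:
# the Schrödinger weight and ground-state transform; `exp` is onto `SU(N)^E`; `Γ = 0` forces constancy

HONEST FRAMING: venture file (cell `pub-ymgap`, track (a), seat p2); plumbing towards a kernel proof
of the multi-link Bakry–Émery Poincaré inequality on `SU(N)^E`, copied from the one-link tree file
`SUNBakryEmeryPoincare.lean` (Part F, "The potential, its Schrödinger weight…" and "Every element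
of `SU(N)` is an exponential…"), for a GENERAL smooth polynomial potential `S` in place of the
one-link `c Re tr(Q B)`:

* `schW S = ¼ Γ(S,S) + ½ ΔS` and the ground-state identities
  `e^{S} Γ(e^{-S/2}p, e^{-S/2}p) = Γ(p,p) - p Γ(S,p) + ¼ p² Γ(S,S)`,
  `L_S(e^{-S/2}p) = e^{-S/2}(Δp - W p)`;
* `exists_skew_exp_eq_emb`: every `g ∈ SU(N)^E` is `exp Y` with `Y ∈ 𝔰𝔲(N)^E` (linkwise, from the
  one-link `exists_skew_traceless_exp_eq`);
* `eq_of_Gam_eq_zero`: if `Γ(F,F) = 0` on `SU(N)^E` then `F` is constant on `SU(N)^E`.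

## References

* Tree file `SUNBakryEmeryPoincare.lean`, Part F; Bröcker–tom Dieck, GTM 98, IV (3.1).
-/

noncomputable section

open scoped Matrix ComplexConjugate BigOperators Matrix.Norms.Frobenius ContDiff Topology
open Matrix Complex Finset
open Literature.MathematicalPhysics.QuantumFieldTheory
open Literature.MathematicalPhysics.QuantumFieldTheory.SUNBakryEmery
  (FrameIdx frame SUN expSU coe_expSU exists_skew_traceless_exp_eq)

namespace Summit.Ventures.YMGap

namespace LatticeBakryEmery

universe u

variable {ι : Type u} [Fintype ι] [DecidableEq ι] {N : ℕ}

/-! ### The Schrödinger weight `W = ¼Γ(S,S) + ½ΔS` -/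

/-- The **Schrödinger weight** `W = ¼ Γ(S,S) + ½ ΔS` of the ground-state transform
`e^{S/2} L_S e^{-S/2} = Δ - W`. -/
def schW (S : Cfg ι N → ℝ) : Cfg ι N → ℝ :=
  fun Q => (1 / 4) * Gam S S Q + (1 / 2) * Lap S Q

/-- `W ∈ 𝒫_{2d}` for `S ∈ 𝒫_d`. -/
theorem schW_mem_polySpace {dS : ℕ} {S : Cfg ι N → ℝ} (hS : S ∈ polySpace ι N dS) :
    schW S ∈ polySpace ι N (dS + dS) := by
  have h1 : Gam S S ∈ polySpace ι N (dS + dS) := Gam_mem_polySpace hS hS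
  have h2 : Lap S ∈ polySpace ι N (dS + dS) := polySpace_mono (Nat.le_add_right _ _) (Lap_mem_polySpace hS)
  have : schW S = (1 / 4 : ℝ) • Gam S S + (1 / 2 : ℝ) • Lap S := by
    funext Q; simp [schW]
  rw [this]
  exact Submodule.add_mem _ (Submodule.smul_mem _ _ h1) (Submodule.smul_mem _ _ h2)

/-- `W` is smooth (for smooth `S`). -/
theorem contDiff_schW {S : Cfg ι N → ℝ} (hS : ContDiff ℝ ∞ S) : ContDiff ℝ ∞ (schW S) :=
  (contDiff_const.mul (contDiff_Gam hS hS)).add (contDiff_const.mul (contDiff_Lap hS))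

/-- `(Δ - W) p ∈ 𝒫_{n+2d}` for `p ∈ 𝒫_n`, `S ∈ 𝒫_d`. -/
theorem Lap_sub_schW_mul_mem {n dS : ℕ} {S : Cfg ι N → ℝ} (hS : S ∈ polySpace ι N dS) {p : Cfg ι N → ℝ}
    (hp : p ∈ polySpace ι N n) : Lap p - schW S * p ∈ polySpace ι N (n + (dS + dS)) := by
  refine Submodule.sub_mem _ (polySpace_mono (Nat.le_add_right n _) (Lap_mem_polySpace hp)) ?_
  have h := mul_mem_polySpace (schW_mem_polySpace hS) hp
  rwa [add_comm] at h

/-- `W = 0` for the zero potential. -/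
theorem schW_zero : schW (fun _ : Cfg ι N => (0 : ℝ)) = 0 := by
  funext Q
  have h1 : Gam (fun _ : Cfg ι N => (0 : ℝ)) (fun _ => (0 : ℝ)) Q = 0 := by simp [Gam, algD_const]
  have h2 : Lap (fun _ : Cfg ι N => (0 : ℝ)) Q = 0 := by
    simp only [Lap]
    refine sum_eq_zero fun a _ => ?_
    rw [algD_const]
    have : algD (bframe a) (0 : Cfg ι N → ℝ) = 0 := algD_const 0 _
    rw [this, Pi.zero_apply]
  simp only [schW, h1, h2, Pi.zero_apply, mul_zero, add_zero]

section Calculus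

omit [DecidableEq ι] in
/-- `D_A (e^{-S/2} p) = e^{-S/2} (D_A p - ½ p D_A S)`. -/
theorem algD_groundState {S p : Cfg ι N → ℝ} (hS : ContDiff ℝ ∞ S) (hp : ContDiff ℝ ∞ p) (A : Cfg ι N) :
    algD A (fun Q => Real.exp (-S Q / 2) * p Q) =
      fun Q => Real.exp (-S Q / 2) * (algD A p Q - (1 / 2) * p Q * algD A S Q) := by
  have hS' : ContDiff ℝ ∞ (fun Q => -S Q / 2) := by
    have : (fun Q => -S Q / 2) = fun Q => (-(1 / 2) : ℝ) * S Q := by funext Q; ring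
    rw [this]; exact contDiff_const.mul hS
  rw [algD_fun_mul hS'.exp hp, algD_exp hS']
  have hD : algD A (fun Q => -S Q / 2) = fun Q => (-(1 / 2) : ℝ) * algD A S Q := by
    have : (fun Q => -S Q / 2) = fun Q => (-(1 / 2) : ℝ) * S Q := by funext Q; ring
    rw [this, algD_const_mul hS]
  rw [hD]
  funext Q
  ring

omit [DecidableEq ι] in
/-- Smoothness of the ground-state transform. -/
theorem contDiff_groundState {S p : Cfg ι N → ℝ} (hS : ContDiff ℝ ∞ S) (hp : ContDiff ℝ ∞ p) :
    ContDiff ℝ ∞ (fun Q => Real.exp (-S Q / 2) * p Q) := by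
  have hS' : ContDiff ℝ ∞ (fun Q => -S Q / 2) := by
    have : (fun Q => -S Q / 2) = fun Q => (-(1 / 2) : ℝ) * S Q := by funext Q; ring
    rw [this]; exact contDiff_const.mul hS
  exact hS'.exp.mul hp

/-- **Ground-state transform of the carré du champ**:
`e^{S} Γ(e^{-S/2}p, e^{-S/2}p) = Γ(p,p) - p Γ(S,p) + ¼ p² Γ(S,S)`. -/
theorem exp_mul_Gam_groundState {S p : Cfg ι N → ℝ} (hS : ContDiff ℝ ∞ S) (hp : ContDiff ℝ ∞ p) (Q : Cfg ι N) :
    Real.exp (S Q) * Gam (fun Q => Real.exp (-S Q / 2) * p Q) (fun Q => Real.exp (-S Q / 2) * p Q) Q =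
      Gam p p Q - p Q * Gam S p Q + (1 / 4) * p Q ^ 2 * Gam S S Q := by
  simp only [Gam, algD_groundState hS hp, mul_sum]
  rw [← sum_sub_distrib, ← sum_add_distrib]
  refine sum_congr rfl fun a _ => ?_
  have he : Real.exp (S Q) * (Real.exp (-S Q / 2) * Real.exp (-S Q / 2)) = 1 := by
    rw [← Real.exp_add, ← Real.exp_add, show S Q + (-S Q / 2 + -S Q / 2) = 0 by ring, Real.exp_zero]
  calc Real.exp (S Q) * (Real.exp (-S Q / 2) * (algD (bframe a) p Q - 1 / 2 * p Q * algD (bframe a) S Q) *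
        (Real.exp (-S Q / 2) * (algD (bframe a) p Q - 1 / 2 * p Q * algD (bframe a) S Q)))
      = Real.exp (S Q) * (Real.exp (-S Q / 2) * Real.exp (-S Q / 2)) *
          (algD (bframe a) p Q - 1 / 2 * p Q * algD (bframe a) S Q) ^ 2 := by ring
    _ = _ := by rw [he]; ring

/-- **Ground-state transform of the generator**: `L_S (e^{-S/2} p) = e^{-S/2} (Δp - W p)`,
`W = ¼ Γ(S,S) + ½ ΔS`. -/
theorem genL_groundState {S p : Cfg ι N → ℝ} (hS : ContDiff ℝ ∞ S) (hp : ContDiff ℝ ∞ p) (Q : Cfg ι N) :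
    genL S (fun Q => Real.exp (-S Q / 2) * p Q) Q =
      Real.exp (-S Q / 2) * (Lap p Q - ((1 / 4) * Gam S S Q + (1 / 2) * Lap S Q) * p Q) := by
  set r : BIdx ι N → Cfg ι N → ℝ :=
    fun a Q => algD (bframe a) p Q - (1 / 2) * p Q * algD (bframe a) S Q with hr
  have hrc : ∀ a, ContDiff ℝ ∞ (r a) := fun a =>
    (contDiff_algD hp _).sub ((contDiff_const.mul hp).mul (contDiff_algD hS _))
  have hq1 : ∀ a, algD (bframe a) (fun Q => Real.exp (-S Q / 2) * p Q) = fun Q => Real.exp (-S Q / 2) * r a Q :=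
    fun a => algD_groundState hS hp _
  have hq2 : ∀ a, algD (bframe a) (algD (bframe a) (fun Q => Real.exp (-S Q / 2) * p Q)) Q =
      Real.exp (-S Q / 2) * (algD (bframe a) (r a) Q - (1 / 2) * r a Q * algD (bframe a) S Q) := fun a => by
    rw [hq1, algD_groundState hS (hrc a)]
  have hr2 : ∀ a, algD (bframe a) (r a) Q = algD (bframe a) (algD (bframe a) p) Q -
      (1 / 2) * (algD (bframe a) p Q * algD (bframe a) S Q + p Q * algD (bframe a) (algD (bframe a) S) Q) := by
    intro a
    have e1 := congrFun (algD_sub (F := algD (bframe a) p) (G := fun Q => 1 / 2 * p Q * algD (bframe a) S Q)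
      (contDiff_algD hp _) ((contDiff_const.mul hp).mul (contDiff_algD hS _)) (bframe a)) Q
    simp only [Pi.sub_apply] at e1
    have e2 : algD (bframe a) (fun Q => 1 / 2 * p Q * algD (bframe a) S Q) Q =
        (1 / 2) * (algD (bframe a) p Q * algD (bframe a) S Q + p Q * algD (bframe a) (algD (bframe a) S) Q) := by
      have : (fun Q => 1 / 2 * p Q * algD (bframe a) S Q) = fun Q => (1 / 2 : ℝ) * (p Q * algD (bframe a) S Q) := by
        funext Q; ring
      rw [this, algD_const_mul (hp.mul (contDiff_algD hS _)), algD_fun_mul hp (contDiff_algD hS _)]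
      ring
    have e3 : r a = (algD (bframe a) p - fun Q => 1 / 2 * p Q * algD (bframe a) S Q) := rfl
    rw [e3, e1, e2]
  have hL : genL S (fun Q => Real.exp (-S Q / 2) * p Q) Q =
      ∑ a : BIdx ι N, Real.exp (-S Q / 2) * (algD (bframe a) (algD (bframe a) p) Q
        - (1 / 2) * p Q * algD (bframe a) (algD (bframe a) S) Q - (1 / 4) * p Q * algD (bframe a) S Q ^ 2) := by
    show (∑ a : BIdx ι N, algD (bframe a) (algD (bframe a) (fun Q => Real.exp (-S Q / 2) * p Q)) Q) +
      ∑ a : BIdx ι N, algD (bframe a) S Q * algD (bframe a) (fun Q => Real.exp (-S Q / 2) * p Q) Q = _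
    rw [← sum_add_distrib]
    refine sum_congr rfl fun a _ => ?_
    rw [hq2, hq1, hr2]
    simp only [hr]
    ring
  have hR : Real.exp (-S Q / 2) * (Lap p Q - ((1 / 4) * Gam S S Q + (1 / 2) * Lap S Q) * p Q) =
      ∑ a : BIdx ι N, Real.exp (-S Q / 2) * (algD (bframe a) (algD (bframe a) p) Q
        - (1 / 2) * p Q * algD (bframe a) (algD (bframe a) S) Q - (1 / 4) * p Q * algD (bframe a) S Q ^ 2) := by
    simp only [Lap, Gam]
    rw [Finset.mul_sum, Finset.mul_sum, ← sum_add_distrib, Finset.sum_mul, ← sum_sub_distrib, Finset.mul_sum]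
    refine sum_congr rfl fun a _ => ?_
    ring
  rw [hL, hR]

end Calculus

/-! ### Every element of `SU(N)^E` is an exponential; functions with `Γ = 0` are constant -/

omit [Fintype ι] [DecidableEq ι] in
/-- The identity configuration: `emb 1 = 1`. -/
@[simp] theorem emb_one : emb (1 : PSU ι N) = (1 : Cfg ι N) := by
  funext e; simp [emb]

omit [DecidableEq ι] in
/-- **`exp : 𝔰𝔲(N)^E → SU(N)^E` is onto** (linkwise, Bröcker–tom Dieck IV (3.1)). -/
theorem exists_skew_exp_eq_emb (hN : N ≠ 0) (g : PSU ι N) :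
    ∃ Y : Cfg ι N, (∀ e, (Y e)ᴴ = -Y e) ∧ (∀ e, (Y e).trace = 0) ∧ NormedSpace.exp Y = emb g := by
  choose Y hY hY0 hYg using fun e => exists_skew_traceless_exp_eq hN (g e)
  refine ⟨Y, hY, hY0, ?_⟩
  rw [show NormedSpace.exp Y = fun e => NormedSpace.exp (Y e) from Pi.exp_def _]
  funext e
  rw [hYg e, emb_apply]

omit [DecidableEq ι] in
/-- The one-parameter subgroup of `SU(N)^E` generated by `Y ∈ 𝔰𝔲(N)^E`, seen in the algebra:
`exp(tY) = emb (e ↦ expSU(t Y_e))`. -/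
theorem exp_smul_eq_emb {Y : Cfg ι N} (hY : ∀ e, (Y e)ᴴ = -Y e) (hY0 : ∀ e, (Y e).trace = 0) (t : ℝ) :
    NormedSpace.exp (t • Y) = emb (fun e => expSU (hY e) (hY0 e) t) := by
  rw [show NormedSpace.exp (t • Y) = fun e => NormedSpace.exp ((t • Y) e) from Pi.exp_def _]
  funext e
  rw [emb_apply, coe_expSU, Pi.smul_apply]

/-- **Vanishing carré du champ forces constancy on `SU(N)^E`**: if `Γ(F,F) = 0` on `SU(N)^E` then
`F(g) = F(1)` for all `g ∈ SU(N)^E` (connectedness via the exponential map). -/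
theorem eq_of_Gam_eq_zero (hN : N ≠ 0) {F : Cfg ι N → ℝ} (hF : ContDiff ℝ ∞ F)
    (hΓ : ∀ g : PSU ι N, Gam F F (emb g) = 0) (g : PSU ι N) : F (emb g) = F (1 : Cfg ι N) := by
  obtain ⟨Y, hY, hY0, hYg⟩ := exists_skew_exp_eq_emb hN g
  -- every block-frame derivative of `F` vanishes on `SU(N)^E`, hence so does `D_Y F`
  have hDa : ∀ (h : PSU ι N) (a : BIdx ι N), algD (bframe a) F (emb h) = 0 := by
    intro h a
    have hs : ∑ b : BIdx ι N, algD (bframe b) F (emb h) ^ 2 = 0 := by rw [← Gam_self_eq_sum_sq]; exact hΓ h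
    have := (sum_eq_zero_iff_of_nonneg fun b _ => sq_nonneg (algD (bframe b) F (emb h))).1 hs a (mem_univ a)
    exact pow_eq_zero_iff (n := 2) (by norm_num) |>.1 this
  have hDY : ∀ h : PSU ι N, algD Y F (emb h) = 0 := fun h => by
    rw [algD_eq_sum_bframe hN hY hY0]
    exact sum_eq_zero fun a _ => by rw [hDa h a, mul_zero]
  have hflow : ∀ t : ℝ, algD Y F ((1 : Cfg ι N) * NormedSpace.exp (t • Y)) = 0 := by
    intro t
    rw [one_mul, exp_smul_eq_emb hY hY0]
    exact hDY _
  have h := apply_mul_exp_eq_of_algD_eq_zero hF 1 Y hflow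
  rw [one_mul] at h
  exact ((congrArg F hYg).symm.trans h)

end LatticeBakryEmery

end Summit.Ventures.YMGap
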